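/-
HONEST FRAMING: certified error envelopes and provably optimal rounding/accumulation schemes for
low-precision formats under stated cost models; every table by two implementations; no hardware
or vendor claims.
-/
import Summits.Ventures.CertifiedArithmetic.LowPrec.OptDemotionBudgetCert

/-!
# The demotion law (Theorem T8), part 7f(B): kernel certificates for EIGHT summands at (q,p) = (4,2), blocks 5–9

`decide +kernel` evaluations of `budgetCheck 4 2` (part 7c) on the 429 ordered shapes with 8 leaves,
cut into 20 blocks of 22 shapes (`chunk`, part 7d; ≈ 1 minute of kernel time each): parts 7f(A),
7f(B), 7f(C) hold blocks 0–4, 5–9, 10–14; part 7f (`OptDemotionBudgetCert8`) holds blocks 15–19,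
the reassembly `budgetCheck_4_2_eight`, `budgetCheck_4_2_upTo8` (all 626 ordered shapes with at
most 8 leaves) and `conjectureD_4_2_of_le_eight`.
-/

namespace Summit.Ventures.CertifiedArithmetic.LowPrec.Opt

open Literature.ComputerArithmetic.JeannerodRump2018
open Literature.ComputerArithmetic.JeannerodRump2018.SumTree

/-- (4,2), the 429 shapes with 8 leaves, block 5 (shapes 110–131). -/
theorem budgetCheck_4_2_eight_5 : (chunk (shapesN 8) 22 5).all (budgetCheck 4 2) = true := by
  decide +kernel

/-- (4,2), the 429 shapes with 8 leaves, block 6 (shapes 132–153). -/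
theorem budgetCheck_4_2_eight_6 : (chunk (shapesN 8) 22 6).all (budgetCheck 4 2) = true := by
  decide +kernel

/-- (4,2), the 429 shapes with 8 leaves, block 7 (shapes 154–175). -/
theorem budgetCheck_4_2_eight_7 : (chunk (shapesN 8) 22 7).all (budgetCheck 4 2) = true := by
  decide +kernel

/-- (4,2), the 429 shapes with 8 leaves, block 8 (shapes 176–197). -/
theorem budgetCheck_4_2_eight_8 : (chunk (shapesN 8) 22 8).all (budgetCheck 4 2) = true := by
  decide +kernel

/-- (4,2), the 429 shapes with 8 leaves, block 9 (shapes 198–219). -/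
theorem budgetCheck_4_2_eight_9 : (chunk (shapesN 8) 22 9).all (budgetCheck 4 2) = true := by
  decide +kernel

end Summit.Ventures.CertifiedArithmetic.LowPrec.Opt
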